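import Mathlib
import Literature.MathematicalPhysics.QuantumFieldTheory.Balaban1983to89.T4EtaRateSiteTorus

/-!
# `Balaban1983to89.T4EtaRateOperatorTorus` — THE OPERATOR LAYER OF THE TYPED NE2 SHAPES ON THE UNIT TORUS: a concrete
`B9.Geometry` with the ARGUMENT SORT REALISED (test functions on the unit torus, point localisation, the sup norm), the
η-DIFFERENCE CONVOLUTION OPERATOR seen through the four (3.42) entries, the READOUT operator layer ⟺ site layer, and the
FIRST INHABITANTS of `T4EtaRate.EtaRateIneq342` / `NE2PlusOperator` / `NE2ZeroOperator` BY NAME — the (1.66)-layer torus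
entry kernels at `γ = 1` and at King's `γ = 2`, uniformly in the volume

Cell `pub-balaban`, unit `b2b-balaban-pv25-g19` (the η-rate lineage: `T4EtaRate` p178744, `T4RateAlgebra` p178920,
`T4OperatorRateLiaison` p185254, `T4EtaRateUnitWitness` p185409, `T4EtaRateDefect` p187761, `T4EtaRateDefectSite` p187690,
`T4EtaRateSiteOfRatePair` p188614, `T4EtaRateSiteTorus` p190929, `T4EtaRateSiteTorus163` p191378; T4-DAG node U1a = the
NE2 background layer, record `t4/T4-EST-U1a.md`).  Self-row T4-U1a.S-NE2-OPERATOR-TORUS° = the cell's architectural seam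
G-t4-U1a-5 (located by gen 13 while writing `T4EtaRateDefectSite`), option (a), AT `U ≡ 1` ON THE UNIT TORUS.  The seam,
verbatim from the cell's GAPS.md: *"`T4EtaRate.EtaRateIneq342` (the OPERATOR layer of NE2⁺, shape of [B9] (3.42) p.397)
quantifies over the ABSTRACT argument type `g.Loc` of `B9.Geometry` (supports `suppIn`/`suppInT`, sizes
`supNorm`/`l2Norm`/`wNorm`/`holder`) … no REALISATION MAP `g.Loc → (X → ℝ)` … exists in the tree, so the operator layer
cannot be read out of block majorants the way the site layer now is; this is a typing seam, not an estimate: either (a) a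
concrete `B9.Geometry` instance fixes `Loc := {f : X → ℝ // …}` with the obvious norms (then `EtaRateIneq342` follows …),
or (b) …"*.  Before this module the tree had NO inhabitant of `EtaRateIneq342`, `NE2PlusOperator` or `NE2ZeroOperator` (the
unit layer `NE2PlusUnit`/`NE2ZeroUnit` and the site layer `NE2PlusSite`/`NE2ZeroSite` are inhabited: `T4EtaRateUnitWitness`,
`T4EtaRateSiteOfRatePair`, `T4EtaRateSiteTorus`, `T4EtaRateSiteTorus163`).

## Contents

* §0 TORUS METRIC BOOKKEEPING (the one new ingredient the readout needs): the torus sup-distance of box representatives is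
  subadditive, even, vanishes at `0`, and a unit step moves it by at most `1` (`tn_add_le`, `tn_neg`, `tn_zero`,
  `tn_unitVec_le`, `tn_le_add_unitVec`, `tn_le_sub_unitVec`) — from b04's `circAbs_add_le` / `circAbs_neg` / `circAbs_zero`
  (`B4Sect5Torus`) and b06's `toT`/`rep` calculus (`B6LowerBound2153Torus`), nothing re-derived.
* §1 THE OPERATOR CARRIER `torusOpGeo d L M k N : B9.Geometry`: the torus site carrier of `T4EtaRateSiteTorus.torusSiteGeo`
  (SAME `Site = Tor N`, `scale ≡ k`, `η = (L^k)⁻¹`, `L`, `M`, `dist y y′ = |y − y′|_{T,∞}`; `L^jη = 1`) with the argument sort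
  REALISED: `Loc := Tor N → ℝ`; `suppIn λ y′ := supp λ ⊂ {y′}`; `suppInT λ y′ := supp λ ⊂ {z : |z − y′|_{T,∞} ≤ 1}`;
  `supNorm λ := max_z |λ z|`; `l2Norm λ := (Σ_z λ(z)²)^{1/2}`; the weighted / Hölder sizes and the cut-off sort INERT (`0` /
  `Unit`; the NE2 operator shapes read only `e`, `suppIn`, `supNorm`, `len`, `dist`).  THE MODEL (said once, loudly): print
  p. 397 [PDF 9] recalls *"if y ∈ Λ_j, then Δ(y) = B^j(y), and Δ̃(y) is a cube of the size 2L^jη on the lattice T_η with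
  center at the point y"*; here every site has the top scale `j = k` (`L^jη = 1`) and THE FINE LATTICE `T_η` INSIDE EACH UNIT
  BLOCK IS COLLAPSED TO THE BLOCK'S LABEL `y ∈ Λ_k = Tor N`: test functions, operators and derivatives live on the block labels,
  `supp λ ⊂ Δ(y′)` is read `supp λ ⊂ {y′}`, `supp λ ⊂ Δ̃(y′)` is read `supp λ ⊂ {z : |z − y′|_{T,∞} ≤ 1}`, `sup_{x ∈ Δ(y)}` is
  evaluation at `y`, and the covariant derivatives at `U ≡ 1` are the unit-lattice forward differences `∇_μ f(y) = f(y + e_μ) −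
  f(y)`, their adjoints `∇*_μ λ(z) = λ(z − e_μ) − λ(z)` and the lattice Laplacian `Δf(y) = Σ_μ (f(y + e_μ) + f(y − e_μ) − 2f(y))`.
  This is a MODEL of [B9]'s fine-lattice operators — the coarsest faithful one in which (3.42)'s quantifier structure
  (`∀ n λ y y′, supp λ ⊂ Δ(y′) → entry_n ≤ B₀·[(L^jη)², L^jη, L^jη, 1]_n·e^{−δ₀d(y,y′)}·|λ|`) is non-trivially typed; it is NOT
  the η-lattice operator theory of [B9] Sect. C.
* §2 THE OPERATOR: `conv K λ (y) = Σ_z K(y − z)λ(z)` (translation-invariant kernel on the unit torus), `fdiffT`, `fdiffAdjT`,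
  `lapT`; the four (3.42)-ENTRIES `opEntries K λ y = ![|Kλ(y)|, Σ_μ|∇_μKλ(y)|, Σ_μ|K∇*_μλ(y)|, |ΔKλ(y)|]` (the vector-valued
  entries summed over directions — the ℓ¹ size, which dominates max and Euclidean); `opKernelFamily Xf Xc L M k :
  B9.KernelFamily (torusOpGeo d L M k N) pt9Bg` = these entries for the η-DIFFERENCE KERNEL `K = Xf − Xc` (Hölder / L² /
  global entries `h1 e4 h2 l2 glob` INERT `0` — (3.43)–(3.47) are not modelled); identities `conv_of_suppIn` (a point-supported
  argument collapses the sum) and `conv_fdiffAdjT` (`K∇*_μλ (y) = Kλ(y − e_μ) − Kλ(y)`, translation invariance).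
* §3 THE READOUT, one `(N, k, M)`: `etaRateIneq342_torus_of_site` — `EtaRateIneqSite d′ p (torusStepKernel Xf Xc L M k) C δ γ U`
  (`δ ≥ 0`, `L > 0`) IMPLIES `EtaRateIneq342 (opKernelFamily Xf Xc L M k) (B0op d δ C) δ γ U` with the EXPLICIT constant
  `B0op d δ C = 4(d+1)e^{δ}C` (one site bound per kernel value, §0's unit-step Lipschitz bound `e^{−δ|a ± e_μ|} ≤ e^{δ}e^{−δ|a|}`,
  `d + 1` directions, at most four kernel values per entry); and conversely `site_of_etaRateIneq342_torus` — the operator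
  inequality at entry `0` against the point mass `λ = 𝟙_{0}` RETURNS the site bound with the same `(B₀, δ, γ)`.  On the torus
  model the two typed layers are EQUIVALENT up to the constant `4(d+1)e^{δ}`.
* §4 THE PAIRED-INSTANCE FAMILY over the index `(k, N, M)` of `T4EtaRateSiteTorus.TorusIndex` (`torusOpPairing` — identity
  pairing, test functions transported identically; `torusOpInstance`; `torusOpKernelFamilies X`) and the PACKAGED READOUT:
  `ne2PlusOperator_torus_of_ne2PlusSite` / `ne2ZeroOperator_torus_of_ne2PlusSite` (`NE2PlusSite d′ p c35` on the site family
  ⟹ `NE2PlusOperator c35` / `NE2ZeroOperator` on the operator family, constants `(M₅, δ, a₀, 4(d+1)e^{δ}C, γ)`),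
  `ne2ZeroSite_torus_of_ne2ZeroOperator` (converse), the producers from a `(k, N)`-uniform torus step bound
  `ne2PlusOperator_torus_of_bound(_rpow)` / `ne2ZeroOperator_torus_of_bound(_rpow)`, the EQUIVALENCES
  `ne2ZeroOperator_torus_iff_bound` / `ne2PlusOperator_torus_iff_bound` / `ne2PlusOperator_torus_iff_ne2PlusSite` (the packaged
  operator type on the torus family IS "a `(k, N)`-uniform torus step bound with positive constants" IS the packaged site
  type — neither vacuous nor more), and the SEPARATING FAMILY `not_ne2ZeroOperator_torus_pow_two` /
  `not_ne2PlusOperator_torus_pow_two` (the rate-less family `X_N k ≡ 2^k` at `L = 2` inhabits neither).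
* §5 INHABITANTS BY NAME: `etaRateIneq342_ksum166` / `ne2PlusOperator_ksum166` / `ne2ZeroOperator_ksum166` (the (1.66)-layer
  torus entry kernels `Re K^{(L^k)}_{ab,N}`, `μ ≠ ν`, every `L ≥ 1`: `γ = 1`, `δ = delta166T d`, from
  `T4EtaRateSiteTorus.ksum166_step_bound` = t4-ne2-p2's `T4GaugeActionRateStrip.ksum_rate_king`) and `…_king` (King's full
  exponent `γ = 2`, `δ = delta166T2 d`, from `ksum166_step_bound_king` = `T4Rate166StripDirect.ksum_rate2_king`) — THE FIRST
  INHABITANTS OF THE OPERATOR LAYER IN THE TREE, for every geometric constant `c35`, uniformly in `(k, N, M)`.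

## HONEST SCOPE / what is NOT claimed

(i) `U ≡ 1`, single (top) scale, linear layer, the unit torus of an arbitrary period vector; the fine lattice inside unit
blocks COLLAPSED (the MODEL of §1 — block labels for points, unit-lattice differences for covariant derivatives, point /
unit-ball support for `Δ(y′)` / `Δ̃(y′)`); the Hölder, `L²` and global entries (3.43)–(3.47) and the weighted norms
(3.40)–(3.41) are NOT modelled (inert fields).  (ii) As in every leaf of this lineage since `T4EtaRateUnitWitness`: in §4–§5
the background quantifier of `NE2PlusOperator` ranges over `{U ≡ 1}` and (3.35) is trivial there — NE2⁰ CONTENT inside NE2⁺'s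
TYPE; the background-dependent estimate NE2⁺ (`T4EtaRate` §3, NOT PRINTED) is neither printed nor claimed; the NOT-PRINTED
residue of NE2⁺ (cell G-t4-U1a-4′) is untouched.  Rates, decay and the uniformity in `(k, N, M)` are genuine and come from the
cited prover modules through `T4EtaRateSiteTorus`.  (iii) Nothing printed is used as a hypothesis; no Prop-valued published
fact is introduced; the [cite] tags locate SHAPES and OBJECTS only, all re-used from cross-read tree headers: [B9] (3.42) and
the `Δ(y)`/`Δ̃(y)` sentence p. 397 [PDF 9] (via `B9.lean`), Thm 3.1 p. 397 and Thm 3.14 pp. 426–427 (quantifier template, via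
`T4EtaRate`); [King1986] p. 664 (identity pairing), Prop. 3.9 (3.73) p. 665 (the exponent γ), Lemma 4.5 (4.38) p. 674 (the
printed `A = 0` SIBLING format); [Balaban1984PropagatorsI] (1.29) p. 23 (the torus), p. 17 l. 30 / p. 36 l. 20–23 (torus
metric, dictionary of `B4TorusKernel`), (1.66) p. 29 (the object of §5, through the cited modules).  (iv) G-t4-U1a-5 is
answered IN THE MODEL ONLY: the realisation map for the multi-scale 𝔅 of the T⁴ assembly (blocks of all scales `j ≤ k`, the
η-lattice inside them, [B9]'s norms (3.39)–(3.41)) is not constructed here and stays with the seat that instantiates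
`B9.Geometry` for the assembly.  NOT NE2⁺, NOT NE1′, NOT continuum, NOT infinite-volume Yang–Mills, NOT a mass gap, NOT Clay;
rung (B)+1 finite-`T⁴` scoping; NOT summit progress.

HONEST FRAMING (cell framing — a PARAPHRASE of `HOME/t4/T4-DAG.md` PAGE 1, not a quotation of it; wording inherited from the
headers of this lineage's earlier leaves): T4 is OPEN. The deliverables are: located quotations, a uniformity census, typed
hypothesis shapes, estimate sketches with every non-printed step flagged, and kernel-checked bookkeeping lemmas. None of this
is summit progress.

ABSOLUTE RULE (cell, verbatim): No internally-minted statement may enter as a cited fact. Every hypothesis is either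
kernel-proved in this package or a verbatim quotation of a PUBLISHED theorem with page reference. The manuscript(s) under
audit are NOT citable for their own disputed steps — they are the thing under adjudication; programme-internal
(2001/route/tribunal) claims are never citable.

Imports BY NAME, nothing modified: `T4EtaRateSiteTorus` (own lineage: the torus site carrier `torusSiteGeo`, `torusStepKernel`,
`TorusIndex`, `torusInstance`, `TorusFamily`, `torusStepKernels`, `torusSupNorm_rep_toT`, `etaRateIneqSite_torus_iff'`,
`ne2PlusSite_torus_of_bound_rpow`, `exists_bound_of_ne2ZeroSite_torus`, `not_ne2ZeroSite_torus_pow_two`, the (1.66) inhabitants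
`ksum166Family`, `delta166T(_pos)`, `C166T`, `ksum166_step_bound`, `ne2PlusSite_ksum166`, `delta166T2(_pos)`, `C166T2`,
`ksum166_step_bound_king`, `ne2PlusSite_ksum166_king`; through it `T4EtaRate` (`EtaRateIneq342`, `NE2PlusOperator`,
`NE2ZeroOperator`, `ne2Zero_of_ne2Plus`, `rateFactor_unit`, `eta_rpow_eq_theta_pow`), `T4EtaRateSiteOfRatePair` (`NE2ZeroSite`,
`ne2ZeroSite_of_ne2PlusSite`, `rpow_neg_pow_comm`), `T4EtaRateDefectSite.pt9Bg`, `B9` (`Geometry`, `KernelFamily`, `pref4`)), and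
the torus infrastructure of seats b04 / b05 / b06: `B4TorusKernel.MultiPeriod` (`torusSupNorm`, `circAbs`,
`torusSupNorm_le_supNorm`), `B4Sect5Torus` (`circAbs_add_le`, `circAbs_neg`, `circAbs_zero`), `B4ContourShift.supNorm`,
`B5Prop11Plancherel` (`Tor`, `unitVec`), `B6LowerBound2153Torus` (`toT`, `rep`, `toT_rep`, `toT_add`, `toT_unitVec`),
`B6BondElimination.unitVec_apply`, `B6Cov2156Torus.one_le_M`.
-/

namespace Literature.MathematicalPhysics.QuantumFieldTheory.Balaban1983to89.T4EtaRateOperatorTorus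

open T4EtaRate (rateFactor rateFactor_unit eta_rpow_eq_theta_pow EtaRateIneq342 EtaRateIneqSite NE2PlusSite NE2PlusOperator
  NE2ZeroOperator ne2Zero_of_ne2Plus PairedInstance EtaPairing)
open T4EtaRateDefectSite (pt9Bg)
open T4EtaRateSiteOfRatePair (NE2ZeroSite ne2ZeroSite_of_ne2PlusSite rpow_neg_pow_comm)
open T4EtaRateSiteTorus (torusSiteGeo torusStepKernel TorusIndex torusInstance TorusFamily torusStepKernels
  torusSupNorm_rep_toT etaRateIneqSite_torus_iff' ne2PlusSite_torus_of_bound_rpow exists_bound_of_ne2ZeroSite_torus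
  not_ne2ZeroSite_torus_pow_two ksum166Family delta166T C166T delta166T_pos ksum166_step_bound ne2PlusSite_ksum166
  delta166T2 C166T2 delta166T2_pos ksum166_step_bound_king ne2PlusSite_ksum166_king)
open B5Prop11Plancherel (Tor unitVec)
open B6LowerBound2153Torus (toT rep toT_rep toT_add toT_unitVec)
open B6Cov2156Torus (one_le_M)
open B4TorusKernel.MultiPeriod (torusSupNorm torusSupNorm_le_supNorm circAbs)
open B4Sect5Torus (circAbs_add_le circAbs_neg circAbs_zero)
open B4ContourShift (supNorm)
open B9 (pref4)

noncomputable section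

variable {d : ℕ}

/-! ## §0 Torus metric bookkeeping: subadditivity, evenness, unit steps -/

section Metric

variable (N : Fin (d + 1) → ℕ) [∀ μ, NeZero (N μ)]

/-- The torus sup-distance is subadditive on lattice vectors (coordinatewise `circAbs_add_le`). [folklore] -/
theorem torusSupNorm_add_le (x y : Fin (d + 1) → ℤ) :
    torusSupNorm N (x + y) ≤ torusSupNorm N x + torusSupNorm N y := by
  unfold torusSupNorm
  refine Finset.sup'_le _ _ fun i _ => ?_
  have h : ((circAbs (N i) ((x + y) i) : ℤ) : ℝ) ≤ circAbs (N i) (x i) + circAbs (N i) (y i) := by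
    rw [Pi.add_apply]
    exact_mod_cast circAbs_add_le (one_le_M N i) (x i) (y i)
  exact h.trans (add_le_add
    (Finset.le_sup' (fun j => ((circAbs (N j) (x j) : ℤ) : ℝ)) (Finset.mem_univ i))
    (Finset.le_sup' (fun j => ((circAbs (N j) (y j) : ℤ) : ℝ)) (Finset.mem_univ i)))

/-- The torus sup-distance is even (coordinatewise `circAbs_neg`). [folklore] -/
theorem torusSupNorm_neg (x : Fin (d + 1) → ℤ) : torusSupNorm N (-x) = torusSupNorm N x := by
  unfold torusSupNorm
  have : (fun i : Fin (d + 1) => ((circAbs (N i) ((-x) i) : ℤ) : ℝ)) =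
      fun i => ((circAbs (N i) (x i) : ℤ) : ℝ) := by
    funext i
    rw [Pi.neg_apply, circAbs_neg (one_le_M N i)]
  rw [this]

omit [∀ μ, NeZero (N μ)] in
/-- The torus sup-distance of `0` is `0`. [folklore] -/
theorem torusSupNorm_zero : torusSupNorm N (0 : Fin (d + 1) → ℤ) = 0 := by
  unfold torusSupNorm
  have : (fun i : Fin (d + 1) => ((circAbs (N i) ((0 : Fin (d + 1) → ℤ) i) : ℤ) : ℝ)) = fun _ => 0 := by
    funext i
    rw [Pi.zero_apply, circAbs_zero, Int.cast_zero]
  rw [this, Finset.sup'_const]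

omit [∀ μ, NeZero (N μ)] in
/-- The quotient map commutes with negation. [folklore] -/
theorem toT_neg (x : Fin (d + 1) → ℤ) : toT N (-x) = -toT N x := by
  ext i
  simp [toT]

/-- SUBADDITIVITY ON THE TORUS: `|a + b|_{T,∞} ≤ |a|_{T,∞} + |b|_{T,∞}` for box representatives. [folklore] -/
theorem tn_add_le (a b : Tor N) :
    torusSupNorm N (rep N (a + b)) ≤ torusSupNorm N (rep N a) + torusSupNorm N (rep N b) := by
  have h : a + b = toT N (rep N a + rep N b) := by rw [toT_add, toT_rep, toT_rep]
  rw [h, torusSupNorm_rep_toT]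
  exact torusSupNorm_add_le N _ _

/-- EVENNESS ON THE TORUS: `|−a|_{T,∞} = |a|_{T,∞}`. [folklore] -/
theorem tn_neg (a : Tor N) : torusSupNorm N (rep N (-a)) = torusSupNorm N (rep N a) := by
  have h : -a = toT N (-rep N a) := by rw [toT_neg, toT_rep]
  rw [h, torusSupNorm_rep_toT, torusSupNorm_neg]

/-- `|0|_{T,∞} = 0`. [folklore] -/
theorem tn_zero : torusSupNorm N (rep N (0 : Tor N)) = 0 := by
  have h : (0 : Tor N) = toT N 0 := by
    ext i
    simp [toT]
  rw [h, torusSupNorm_rep_toT, torusSupNorm_zero]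

/-- A UNIT VECTOR HAS TORUS LENGTH AT MOST `1`: `|e_μ|_{T,∞} ≤ 1` (`= 0` when `N_μ = 1`). [folklore] -/
theorem tn_unitVec_le (μ : Fin (d + 1)) : torusSupNorm N (rep N (unitVec N μ)) ≤ 1 := by
  rw [← toT_unitVec, torusSupNorm_rep_toT]
  refine (torusSupNorm_le_supNorm (one_le_M N) _).trans ?_
  unfold supNorm
  refine Finset.sup'_le _ _ fun i _ => ?_
  rw [B6BondElimination.unitVec_apply]
  split_ifs <;> simp

/-- ONE STEP FORWARD MOVES THE TORUS DISTANCE BY AT MOST `1`: `|a|_{T,∞} ≤ |a + e_μ|_{T,∞} + 1`. [folklore] -/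
theorem tn_le_add_unitVec (a : Tor N) (μ : Fin (d + 1)) :
    torusSupNorm N (rep N a) ≤ torusSupNorm N (rep N (a + unitVec N μ)) + 1 := by
  have h := tn_add_le N (a + unitVec N μ) (-unitVec N μ)
  rw [add_neg_cancel_right, tn_neg] at h
  linarith [tn_unitVec_le N μ]

/-- ONE STEP BACKWARD MOVES THE TORUS DISTANCE BY AT MOST `1`: `|a|_{T,∞} ≤ |a − e_μ|_{T,∞} + 1`. [folklore] -/
theorem tn_le_sub_unitVec (a : Tor N) (μ : Fin (d + 1)) :
    torusSupNorm N (rep N a) ≤ torusSupNorm N (rep N (a - unitVec N μ)) + 1 := by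
  have h := tn_add_le N (a - unitVec N μ) (unitVec N μ)
  rw [sub_add_cancel] at h
  linarith [tn_unitVec_le N μ]

end Metric

/-! ## §1 The operator carrier: [B9]'s site carrier on the unit torus with the argument sort REALISED -/

/-- THE OPERATOR CARRIER (G-t4-U1a-5 option (a) in the collapsed single-scale model): the torus site carrier (sites = the unit
torus `Tor N = Π_μ ℤ/N_μ`, every site of scale index `k`, `η = (L^k)⁻¹`, `L^jη = 1`, `dist y y′ = |y − y′|_{T,∞}`, cube-size
parameter `M` inert) with ARGUMENTS `λ : Tor N → ℝ` (test functions on the block labels), `suppIn λ y′` = `supp λ ⊂ {y′}` (the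
model's reading of *"supp λ ⊂ Δ(y′)"*, `Δ(y′) = B^k(y′)` the unit block labelled `y′`), `suppInT λ y′` = `supp λ ⊂ {z : |z −
y′|_{T,∞} ≤ 1}` (the model's reading of `Δ̃(y′)`, *"a cube of the size 2L^jη … with center at the point y"*), `supNorm λ =
max_z |λ(z)|`, `l2Norm λ = (Σ_z λ(z)²)^{1/2}`; weighted / Hölder sizes and the cut-off sort inert.  `reducible`, so that the
`Fintype` / `DecidableEq` instances of `Tor N` are found on its `Site` and `Loc` unfolds to a function type.
[cite: Balaban1985BackgroundPropagators, (3.41)–(3.42) p.397 (site scale convention; the cubes Δ(y), Δ̃(y); shape); Balaban1984PropagatorsI, (1.29) p.23 (the torus) and p.17 l.30 with p.36 l.20–23 (torus metric, dictionary)] -/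
@[reducible] def torusOpGeo (d : ℕ) (L M : ℝ) (k : ℕ) (N : Fin (d + 1) → ℕ) [∀ μ, NeZero (N μ)] : B9.Geometry where
  Site := Tor N
  scale := fun _ => k
  dist := fun y y' => torusSupNorm N (rep N (y - y'))
  k := k
  eta := (L ^ k)⁻¹
  L := L
  M := M
  Loc := Tor N → ℝ
  suppIn := fun lam y' => ∀ z, lam z ≠ 0 → z = y'
  suppInT := fun lam y' => ∀ z, lam z ≠ 0 → torusSupNorm N (rep N (z - y')) ≤ 1
  supNorm := fun lam => Finset.univ.sup' ⟨0, Finset.mem_univ _⟩ fun z => |lam z|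
  l2Norm := fun lam => Real.sqrt (∑ z, lam z ^ 2)
  wNorm := fun _ _ => 0
  holder := fun _ _ => 0
  Cut := Unit
  cutIn := fun _ _ => True
  cutInT := fun _ _ => True
  cutH := fun _ _ => 0
  cutSup := fun _ => 0
  suppInT_of_suppIn := fun lam y' h z hz => by
    rw [h z hz, sub_self, tn_zero]
    exact zero_le_one
  cutInT_of_cutIn := fun _ _ h => h

section Carrier

variable (N : Fin (d + 1) → ℕ) [∀ μ, NeZero (N μ)]

/-- The distance of the operator carrier is the torus sup-distance of a representative of `y − y′` (the SAME as the site
carrier's). [folklore] -/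
@[simp] theorem torusOpGeo_dist (L M : ℝ) (k : ℕ) (y y' : (torusOpGeo d L M k N).Site) :
    (torusOpGeo d L M k N).dist y y' = torusSupNorm N (rep N (y - y')) := rfl

/-- Every site of the operator carrier has physical size `L^kη = 1` (`L ≠ 0`). [folklore] -/
@[simp] theorem torusOpGeo_len {L : ℝ} (hL : L ≠ 0) (M : ℝ) (k : ℕ) (y : (torusOpGeo d L M k N).Site) :
    (torusOpGeo d L M k N).len y = 1 := by
  show L ^ k * (L ^ k)⁻¹ = 1
  exact mul_inv_cancel₀ (pow_ne_zero _ hL)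

/-- The lattice spacing `η = L^{−k}` of the operator carrier is positive (`L > 0`). [folklore] -/
theorem torusOpGeo_eta_pos {L : ℝ} (hL : 0 < L) (M : ℝ) (k : ℕ) : 0 < (torusOpGeo d L M k N).eta :=
  inv_pos.mpr (pow_pos hL k)

/-- King's rate factor on the operator carrier is the clean geometric rate `(η/L^jη)^γ = (L^{−γ})^k`.
[cite: King1986, Prop. 3.9 (3.73) p.665 (rate factor, shape)] -/
theorem rateFactor_torusOpGeo {L : ℝ} (hL : 0 < L) (M : ℝ) (k : ℕ) (γ : ℝ) (y : (torusOpGeo d L M k N).Site) :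
    rateFactor (torusOpGeo d L M k N) γ y = (L ^ (-γ)) ^ k := by
  rw [rateFactor_unit γ (torusOpGeo_len N hL.ne' M k y)]
  exact eta_rpow_eq_theta_pow (g := torusOpGeo d L M k N) rfl hL γ

/-- `|λ(z)| ≤ |λ|` for the realised sup norm. [folklore] -/
theorem abs_le_supNorm_op (L M : ℝ) (k : ℕ) (lam : (torusOpGeo d L M k N).Loc) (z : Tor N) :
    |lam z| ≤ (torusOpGeo d L M k N).supNorm lam :=
  Finset.le_sup' (fun z => |lam z|) (Finset.mem_univ z)

/-- `0 ≤ |λ|`. [folklore] -/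
theorem supNorm_op_nonneg (L M : ℝ) (k : ℕ) (lam : (torusOpGeo d L M k N).Loc) :
    0 ≤ (torusOpGeo d L M k N).supNorm lam :=
  (abs_nonneg (lam 0)).trans (abs_le_supNorm_op N L M k lam 0)

/-- `|λ| ≤ c` as soon as `|λ(z)| ≤ c` for every `z`. [folklore] -/
theorem supNorm_op_le (L M : ℝ) (k : ℕ) (lam : (torusOpGeo d L M k N).Loc) {c : ℝ} (h : ∀ z, |lam z| ≤ c) :
    (torusOpGeo d L M k N).supNorm lam ≤ c := by
  show Finset.univ.sup' ⟨0, Finset.mem_univ _⟩ (fun z => |lam z|) ≤ c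
  exact Finset.sup'_le _ _ fun z _ => h z

end Carrier

/-! ## §2 The convolution operator on the unit torus and the four (3.42) entries -/

section Operator

variable {N : Fin (d + 1) → ℕ} [∀ μ, NeZero (N μ)]

/-- THE TRANSLATION-INVARIANT OPERATOR of kernel `K` on the unit torus: `(Kλ)(y) = Σ_z K(y − z)λ(z)`. [folklore] -/
def conv (K lam : Tor N → ℝ) (y : Tor N) : ℝ := ∑ z, K (y - z) * lam z

/-- the unit-lattice FORWARD DIFFERENCE `∇_μ f(y) = f(y + e_μ) − f(y)` (the covariant derivative at `U ≡ 1` in the model). [folklore] -/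
def fdiffT (μ : Fin (d + 1)) (f : Tor N → ℝ) (y : Tor N) : ℝ := f (y + unitVec N μ) - f y

/-- its ADJOINT `∇*_μ λ(z) = λ(z − e_μ) − λ(z)` (w.r.t. the counting measure: `Σ_z ∇_μf(z)λ(z) = Σ_z f(z)∇*_μλ(z)`). [folklore] -/
def fdiffAdjT (μ : Fin (d + 1)) (f : Tor N → ℝ) (y : Tor N) : ℝ := f (y - unitVec N μ) - f y

/-- the unit-lattice LAPLACIAN `Δf(y) = Σ_μ (f(y + e_μ) + f(y − e_μ) − 2f(y)) = −Σ_μ ∇*_μ∇_μ f(y)`. [folklore] -/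
def lapT (f : Tor N → ℝ) (y : Tor N) : ℝ := ∑ μ, (f (y + unitVec N μ) + f (y - unitVec N μ) - 2 * f y)

/-- A POINT-SUPPORTED ARGUMENT COLLAPSES THE SUM: `supp λ ⊂ {y′} ⇒ (Kλ)(y) = K(y − y′)λ(y′)`. [folklore] -/
theorem conv_of_suppIn {K lam : Tor N → ℝ} {y' : Tor N} (hs : ∀ z, lam z ≠ 0 → z = y') (y : Tor N) :
    conv K lam y = K (y - y') * lam y' := by
  unfold conv
  rw [Finset.sum_eq_single y']
  · intro z _ hz
    have h0 : lam z = 0 := by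
      by_contra h
      exact hz (hs z h)
    rw [h0, mul_zero]
  · intro h
    exact absurd (Finset.mem_univ y') h

/-- Re-indexing a translation-invariant sum: `Σ_z K(y − z)λ(z − e) = Σ_w K(y − e − w)λ(w)`. [folklore] -/
theorem sum_shift (K lam : Tor N → ℝ) (e y : Tor N) :
    ∑ z, K (y - z) * lam (z - e) = ∑ w, K (y - e - w) * lam w := by
  symm
  refine Fintype.sum_equiv (Equiv.addRight e) _ _ fun w => ?_
  have h : y - e - w = y - (w + e) := by abel
  rw [Equiv.coe_addRight, add_sub_cancel_right, h]

/-- TRANSLATION INVARIANCE: `(K∇*_μλ)(y) = (Kλ)(y − e_μ) − (Kλ)(y)`. [folklore] -/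
theorem conv_fdiffAdjT (K lam : Tor N → ℝ) (μ : Fin (d + 1)) (y : Tor N) :
    conv K (fdiffAdjT μ lam) y = conv K lam (y - unitVec N μ) - conv K lam y := by
  simp only [conv, fdiffAdjT, mul_sub, Finset.sum_sub_distrib, sum_shift]

/-- THE FOUR (3.42) ENTRIES of the operator of kernel `K` at argument `λ` and observation site `y` in the collapsed model:
`|(Kλ)(y)|`, `Σ_μ |(∇_μKλ)(y)|`, `Σ_μ |(K∇*_μλ)(y)|`, `|(ΔKλ)(y)|`. [cite: Balaban1985BackgroundPropagators, (3.42) p.397 (the four entries, shape)] -/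
def opEntries (K lam : Tor N → ℝ) (y : Tor N) : Fin 4 → ℝ :=
  ![|conv K lam y|, ∑ μ, |fdiffT μ (conv K lam) y|, ∑ μ, |conv K (fdiffAdjT μ lam) y|, |lapT (conv K lam) y|]

/-- entry `0` is `|(Kλ)(y)|`. [folklore] -/
@[simp] theorem opEntries_zero (K lam : Tor N → ℝ) (y : Tor N) : opEntries K lam y 0 = |conv K lam y| := rfl

/-- entry `1` is `Σ_μ |(∇_μKλ)(y)|`. [folklore] -/
@[simp] theorem opEntries_one (K lam : Tor N → ℝ) (y : Tor N) :
    opEntries K lam y 1 = ∑ μ, |fdiffT μ (conv K lam) y| := rfl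

/-- entry `2` is `Σ_μ |(K∇*_μλ)(y)|`. [folklore] -/
@[simp] theorem opEntries_two (K lam : Tor N → ℝ) (y : Tor N) :
    opEntries K lam y 2 = ∑ μ, |conv K (fdiffAdjT μ lam) y| := rfl

/-- entry `3` is `|(ΔKλ)(y)|`. [folklore] -/
@[simp] theorem opEntries_three (K lam : Tor N → ℝ) (y : Tor N) :
    opEntries K lam y 3 = |lapT (conv K lam) y| := rfl

/-- THE OPERATOR-LAYER KERNEL FAMILY OF THE η-DIFFERENCE `K = Xf − Xc` of two translation-invariant torus functions (fine and
coarse level of a scale-indexed family) over the one-point backgrounds: entries `e n` = `opEntries (Xf − Xc)`; the Hölder /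
`L²` / global entries are INERT (`0`; (3.43)–(3.47) not modelled). [cite: Balaban1985BackgroundPropagators, (3.42) p.397 + Thm 3.14 pp.426–427 (typing template); King1986, p.664 (identity pairing convention before Prop. 3.8)] -/
def opKernelFamily (Xf Xc : Tor N → ℝ) (L M : ℝ) (k : ℕ) : B9.KernelFamily (torusOpGeo d L M k N) pt9Bg where
  e := fun n _ lam y => opEntries (fun t => Xf t - Xc t) lam y n
  h1 := fun _ _ _ _ => 0
  e4 := fun _ _ _ => 0
  h2 := fun _ _ _ _ => 0
  l2 := fun _ _ _ _ => 0
  glob := fun _ _ _ _ => 0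

/-- Unfolding of the entries of `opKernelFamily`. [folklore] -/
@[simp] theorem opKernelFamily_e (Xf Xc : Tor N → ℝ) (L M : ℝ) (k : ℕ) (n : Fin 4) (U : pt9Bg.Cfg)
    (lam : (torusOpGeo d L M k N).Loc) (y : Tor N) :
    (opKernelFamily (N := N) Xf Xc L M k).e n U lam y = opEntries (fun t => Xf t - Xc t) lam y n := rfl

end Operator

/-! ## §3 The readout at one `(N, k, M)`: site bound ⟹ the four (3.42) entries, and back -/

section Readout

variable {N : Fin (d + 1) → ℕ} [∀ μ, NeZero (N μ)]

/-- the site-layer MAJORANT on the torus: `maj C δ R t = C·e^{−δ|t|_{T,∞}}·R` (`R` = the max-rate-factor). [folklore] -/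
def maj (C δ R : ℝ) (N : Fin (d + 1) → ℕ) [∀ μ, NeZero (N μ)] (t : Tor N) : ℝ :=
  C * Real.exp (-(δ * torusSupNorm N (rep N t))) * R

/-- THE READOUT CONSTANT `B0op d δ C = 4(d+1)·e^{δ}·C`. [folklore] -/
def B0op (d : ℕ) (δ C : ℝ) : ℝ := 4 * ((d : ℝ) + 1) * Real.exp δ * C

/-- `B0op d δ C > 0` for `C > 0`. [folklore] -/
theorem B0op_pos (d : ℕ) (δ : ℝ) {C : ℝ} (hC : 0 < C) : 0 < B0op d δ C := by
  unfold B0op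
  positivity

variable {K : Tor N → ℝ} {C δ R : ℝ}

/-- A kernel under the majorant makes the majorant nonnegative. [folklore] -/
theorem maj_nonneg (hB : ∀ t : Tor N, |K t| ≤ maj C δ R N t) (t : Tor N) : 0 ≤ maj C δ R N t :=
  (abs_nonneg _).trans (hB t)

/-- … and `C·R ≥ 0`. [folklore] -/
theorem cr_nonneg (hB : ∀ t : Tor N, |K t| ≤ maj C δ R N t) : 0 ≤ C * R := by
  have h := maj_nonneg hB 0
  have hE := Real.exp_pos (-(δ * torusSupNorm N (rep N (0 : Tor N))))
  have e : maj C δ R N 0 = C * R * Real.exp (-(δ * torusSupNorm N (rep N (0 : Tor N)))) := by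
    unfold maj
    ring
  rw [e] at h
  exact (mul_nonneg_iff_of_pos_right hE).mp h

/-- UNIT-STEP LIPSCHITZ BOUND OF THE WEIGHT, forward: `e^{−δ|a + e_μ|} ≤ e^{δ}·e^{−δ|a|}` (`δ ≥ 0`). [folklore] -/
theorem weight_shift_add (hδ : 0 ≤ δ) (a : Tor N) (μ : Fin (d + 1)) :
    Real.exp (-(δ * torusSupNorm N (rep N (a + unitVec N μ)))) ≤
      Real.exp δ * Real.exp (-(δ * torusSupNorm N (rep N a))) := by
  rw [← Real.exp_add]
  refine Real.exp_le_exp.mpr ?_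
  have h := mul_le_mul_of_nonneg_left (tn_le_add_unitVec N a μ) hδ
  rw [mul_add, mul_one] at h
  linarith

/-- UNIT-STEP LIPSCHITZ BOUND OF THE WEIGHT, backward: `e^{−δ|a − e_μ|} ≤ e^{δ}·e^{−δ|a|}` (`δ ≥ 0`). [folklore] -/
theorem weight_shift_sub (hδ : 0 ≤ δ) (a : Tor N) (μ : Fin (d + 1)) :
    Real.exp (-(δ * torusSupNorm N (rep N (a - unitVec N μ)))) ≤
      Real.exp δ * Real.exp (-(δ * torusSupNorm N (rep N a))) := by
  rw [← Real.exp_add]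
  refine Real.exp_le_exp.mpr ?_
  have h := mul_le_mul_of_nonneg_left (tn_le_sub_unitVec N a μ) hδ
  rw [mul_add, mul_one] at h
  linarith

/-- The majorant one step forward: `maj(a + e_μ) ≤ e^{δ}·maj(a)`. [folklore] -/
theorem maj_shift_add (hB : ∀ t : Tor N, |K t| ≤ maj C δ R N t) (hδ : 0 ≤ δ) (a : Tor N) (μ : Fin (d + 1)) :
    maj C δ R N (a + unitVec N μ) ≤ Real.exp δ * maj C δ R N a := by
  have hCR := cr_nonneg hB
  have hw := weight_shift_add (N := N) hδ a μ
  unfold maj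
  calc C * Real.exp (-(δ * torusSupNorm N (rep N (a + unitVec N μ)))) * R
      = C * R * Real.exp (-(δ * torusSupNorm N (rep N (a + unitVec N μ)))) := by ring
    _ ≤ C * R * (Real.exp δ * Real.exp (-(δ * torusSupNorm N (rep N a)))) := mul_le_mul_of_nonneg_left hw hCR
    _ = Real.exp δ * (C * Real.exp (-(δ * torusSupNorm N (rep N a))) * R) := by ring

/-- The majorant one step backward: `maj(a − e_μ) ≤ e^{δ}·maj(a)`. [folklore] -/
theorem maj_shift_sub (hB : ∀ t : Tor N, |K t| ≤ maj C δ R N t) (hδ : 0 ≤ δ) (a : Tor N) (μ : Fin (d + 1)) :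
    maj C δ R N (a - unitVec N μ) ≤ Real.exp δ * maj C δ R N a := by
  have hCR := cr_nonneg hB
  have hw := weight_shift_sub (N := N) hδ a μ
  unfold maj
  calc C * Real.exp (-(δ * torusSupNorm N (rep N (a - unitVec N μ)))) * R
      = C * R * Real.exp (-(δ * torusSupNorm N (rep N (a - unitVec N μ)))) := by ring
    _ ≤ C * R * (Real.exp δ * Real.exp (-(δ * torusSupNorm N (rep N a)))) := mul_le_mul_of_nonneg_left hw hCR
    _ = Real.exp δ * (C * Real.exp (-(δ * torusSupNorm N (rep N a))) * R) := by ring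

/-- `maj(a) ≤ e^{δ}·maj(a)` (`δ ≥ 0`). [folklore] -/
theorem maj_le_exp_mul (hB : ∀ t : Tor N, |K t| ≤ maj C δ R N t) (hδ : 0 ≤ δ) (a : Tor N) :
    maj C δ R N a ≤ Real.exp δ * maj C δ R N a :=
  le_mul_of_one_le_left (maj_nonneg hB a) (Real.one_le_exp hδ)

variable {lam : Tor N → ℝ} {y' : Tor N} {s : ℝ}

/-- ENTRY 0: `|(Kλ)(y)| ≤ maj(y − y′)·s` for `supp λ ⊂ {y′}`, `|λ(y′)| ≤ s`. [folklore] -/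
theorem entry0_le (hB : ∀ t : Tor N, |K t| ≤ maj C δ R N t) (hs : ∀ z, lam z ≠ 0 → z = y')
    (hsz : |lam y'| ≤ s) (y : Tor N) : |conv K lam y| ≤ maj C δ R N (y - y') * s := by
  rw [conv_of_suppIn hs, abs_mul]
  exact mul_le_mul (hB _) hsz (abs_nonneg _) (maj_nonneg hB _)

/-- one forward-difference term: `|K(y + e_μ − y′) − K(y − y′)|·|λ(y′)| ≤ 2e^{δ}·maj(y − y′)·s`. [folklore] -/
theorem fdiff_term_le (hB : ∀ t : Tor N, |K t| ≤ maj C δ R N t) (hδ : 0 ≤ δ) (hsz : |lam y'| ≤ s)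
    (y : Tor N) (μ : Fin (d + 1)) :
    |K (y + unitVec N μ - y') - K (y - y')| * |lam y'| ≤ 2 * Real.exp δ * (maj C δ R N (y - y') * s) := by
  have h1 : |K (y + unitVec N μ - y')| ≤ Real.exp δ * maj C δ R N (y - y') := by
    have e : y + unitVec N μ - y' = y - y' + unitVec N μ := by abel
    rw [e]
    exact (hB _).trans (maj_shift_add hB hδ _ _)
  have h2 : |K (y - y')| ≤ Real.exp δ * maj C δ R N (y - y') := (hB _).trans (maj_le_exp_mul hB hδ _)
  have hs0 : 0 ≤ s := (abs_nonneg _).trans hsz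
  have hm := maj_nonneg hB (y - y')
  calc |K (y + unitVec N μ - y') - K (y - y')| * |lam y'|
      ≤ (|K (y + unitVec N μ - y')| + |K (y - y')|) * s :=
        mul_le_mul (abs_sub _ _) hsz (abs_nonneg _) (by positivity)
    _ ≤ (Real.exp δ * maj C δ R N (y - y') + Real.exp δ * maj C δ R N (y - y')) * s :=
        mul_le_mul_of_nonneg_right (add_le_add h1 h2) hs0
    _ = 2 * Real.exp δ * (maj C δ R N (y - y') * s) := by ring

/-- one backward-difference term: `|K(y − e_μ − y′) − K(y − y′)|·|λ(y′)| ≤ 2e^{δ}·maj(y − y′)·s`. [folklore] -/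
theorem bdiff_term_le (hB : ∀ t : Tor N, |K t| ≤ maj C δ R N t) (hδ : 0 ≤ δ) (hsz : |lam y'| ≤ s)
    (y : Tor N) (μ : Fin (d + 1)) :
    |K (y - unitVec N μ - y') - K (y - y')| * |lam y'| ≤ 2 * Real.exp δ * (maj C δ R N (y - y') * s) := by
  have h1 : |K (y - unitVec N μ - y')| ≤ Real.exp δ * maj C δ R N (y - y') := by
    have e : y - unitVec N μ - y' = y - y' - unitVec N μ := by abel
    rw [e]
    exact (hB _).trans (maj_shift_sub hB hδ _ _)
  have h2 : |K (y - y')| ≤ Real.exp δ * maj C δ R N (y - y') := (hB _).trans (maj_le_exp_mul hB hδ _)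
  have hs0 : 0 ≤ s := (abs_nonneg _).trans hsz
  have hm := maj_nonneg hB (y - y')
  calc |K (y - unitVec N μ - y') - K (y - y')| * |lam y'|
      ≤ (|K (y - unitVec N μ - y')| + |K (y - y')|) * s :=
        mul_le_mul (abs_sub _ _) hsz (abs_nonneg _) (by positivity)
    _ ≤ (Real.exp δ * maj C δ R N (y - y') + Real.exp δ * maj C δ R N (y - y')) * s :=
        mul_le_mul_of_nonneg_right (add_le_add h1 h2) hs0
    _ = 2 * Real.exp δ * (maj C δ R N (y - y') * s) := by ring

/-- A sum of `d + 1` equal real terms. [folklore] -/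
theorem sum_const_fin (c : ℝ) : ∑ _μ : Fin (d + 1), c = ((d : ℝ) + 1) * c := by
  rw [Finset.sum_const, Finset.card_univ, Fintype.card_fin, nsmul_eq_mul]
  push_cast
  ring

/-- ENTRY 1: `Σ_μ |(∇_μKλ)(y)| ≤ 2(d+1)e^{δ}·maj(y − y′)·s`. [folklore] -/
theorem entry1_le (hB : ∀ t : Tor N, |K t| ≤ maj C δ R N t) (hδ : 0 ≤ δ) (hs : ∀ z, lam z ≠ 0 → z = y')
    (hsz : |lam y'| ≤ s) (y : Tor N) :
    ∑ μ, |fdiffT μ (conv K lam) y| ≤ 2 * ((d : ℝ) + 1) * Real.exp δ * (maj C δ R N (y - y') * s) := by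
  have hterm : ∀ μ, |fdiffT μ (conv K lam) y| ≤ 2 * Real.exp δ * (maj C δ R N (y - y') * s) := by
    intro μ
    unfold fdiffT
    rw [conv_of_suppIn hs, conv_of_suppIn hs, ← sub_mul, abs_mul]
    exact fdiff_term_le hB hδ hsz y μ
  calc ∑ μ, |fdiffT μ (conv K lam) y| ≤ ∑ _μ : Fin (d + 1), 2 * Real.exp δ * (maj C δ R N (y - y') * s) :=
        Finset.sum_le_sum fun μ _ => hterm μ
    _ = 2 * ((d : ℝ) + 1) * Real.exp δ * (maj C δ R N (y - y') * s) := by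
        rw [sum_const_fin]
        ring

/-- ENTRY 2: `Σ_μ |(K∇*_μλ)(y)| ≤ 2(d+1)e^{δ}·maj(y − y′)·s`. [folklore] -/
theorem entry2_le (hB : ∀ t : Tor N, |K t| ≤ maj C δ R N t) (hδ : 0 ≤ δ) (hs : ∀ z, lam z ≠ 0 → z = y')
    (hsz : |lam y'| ≤ s) (y : Tor N) :
    ∑ μ, |conv K (fdiffAdjT μ lam) y| ≤ 2 * ((d : ℝ) + 1) * Real.exp δ * (maj C δ R N (y - y') * s) := by
  have hterm : ∀ μ, |conv K (fdiffAdjT μ lam) y| ≤ 2 * Real.exp δ * (maj C δ R N (y - y') * s) := by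
    intro μ
    rw [conv_fdiffAdjT, conv_of_suppIn hs, conv_of_suppIn hs, ← sub_mul, abs_mul]
    exact bdiff_term_le hB hδ hsz y μ
  calc ∑ μ, |conv K (fdiffAdjT μ lam) y| ≤ ∑ _μ : Fin (d + 1), 2 * Real.exp δ * (maj C δ R N (y - y') * s) :=
        Finset.sum_le_sum fun μ _ => hterm μ
    _ = 2 * ((d : ℝ) + 1) * Real.exp δ * (maj C δ R N (y - y') * s) := by
        rw [sum_const_fin]
        ring

/-- ENTRY 3: `|(ΔKλ)(y)| ≤ 4(d+1)e^{δ}·maj(y − y′)·s`. [folklore] -/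
theorem entry3_le (hB : ∀ t : Tor N, |K t| ≤ maj C δ R N t) (hδ : 0 ≤ δ) (hs : ∀ z, lam z ≠ 0 → z = y')
    (hsz : |lam y'| ≤ s) (y : Tor N) :
    |lapT (conv K lam) y| ≤ 4 * ((d : ℝ) + 1) * Real.exp δ * (maj C δ R N (y - y') * s) := by
  have hterm : ∀ μ, |conv K lam (y + unitVec N μ) + conv K lam (y - unitVec N μ) - 2 * conv K lam y|
      ≤ 4 * Real.exp δ * (maj C δ R N (y - y') * s) := by
    intro μ
    rw [conv_of_suppIn hs, conv_of_suppIn hs, conv_of_suppIn hs]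
    have e : K (y + unitVec N μ - y') * lam y' + K (y - unitVec N μ - y') * lam y' - 2 * (K (y - y') * lam y') =
        (K (y + unitVec N μ - y') - K (y - y')) * lam y' + (K (y - unitVec N μ - y') - K (y - y')) * lam y' := by
      ring
    rw [e]
    calc |(K (y + unitVec N μ - y') - K (y - y')) * lam y' + (K (y - unitVec N μ - y') - K (y - y')) * lam y'|
        ≤ |(K (y + unitVec N μ - y') - K (y - y')) * lam y'| + |(K (y - unitVec N μ - y') - K (y - y')) * lam y'| :=
          abs_add_le _ _
      _ = |K (y + unitVec N μ - y') - K (y - y')| * |lam y'| + |K (y - unitVec N μ - y') - K (y - y')| * |lam y'| := by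
          rw [abs_mul, abs_mul]
      _ ≤ 2 * Real.exp δ * (maj C δ R N (y - y') * s) + 2 * Real.exp δ * (maj C δ R N (y - y') * s) :=
          add_le_add (fdiff_term_le hB hδ hsz y μ) (bdiff_term_le hB hδ hsz y μ)
      _ = 4 * Real.exp δ * (maj C δ R N (y - y') * s) := by ring
  unfold lapT
  calc |∑ μ, (conv K lam (y + unitVec N μ) + conv K lam (y - unitVec N μ) - 2 * conv K lam y)|
      ≤ ∑ μ, |conv K lam (y + unitVec N μ) + conv K lam (y - unitVec N μ) - 2 * conv K lam y| :=
        Finset.abs_sum_le_sum_abs _ _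
    _ ≤ ∑ _μ : Fin (d + 1), 4 * Real.exp δ * (maj C δ R N (y - y') * s) := Finset.sum_le_sum fun μ _ => hterm μ
    _ = 4 * ((d : ℝ) + 1) * Real.exp δ * (maj C δ R N (y - y') * s) := by
        rw [sum_const_fin]
        ring

/-- ALL FOUR ENTRIES under one constant: `entry_n ≤ B0op d δ C·e^{−δ|y − y′|}·R·s` (`supp λ ⊂ {y′}`, `|λ(y′)| ≤ s`, `δ ≥ 0`).
[folklore] -/
theorem opEntries_le (hB : ∀ t : Tor N, |K t| ≤ maj C δ R N t) (hδ : 0 ≤ δ) (hs : ∀ z, lam z ≠ 0 → z = y')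
    (hsz : |lam y'| ≤ s) (y : Tor N) (n : Fin 4) :
    opEntries K lam y n ≤ B0op d δ C * Real.exp (-(δ * torusSupNorm N (rep N (y - y')))) * R * s := by
  have hs0 : 0 ≤ s := (abs_nonneg _).trans hsz
  have hm : 0 ≤ maj C δ R N (y - y') * s := mul_nonneg (maj_nonneg hB _) hs0
  have hexp : 1 ≤ Real.exp δ := Real.one_le_exp hδ
  have hd : (1 : ℝ) ≤ (d : ℝ) + 1 := by
    have : (0 : ℝ) ≤ d := Nat.cast_nonneg d
    linarith
  have hE : B0op d δ C * Real.exp (-(δ * torusSupNorm N (rep N (y - y')))) * R * s =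
      4 * ((d : ℝ) + 1) * Real.exp δ * (maj C δ R N (y - y') * s) := by
    unfold B0op maj
    ring
  rw [hE]
  have hfac : ∀ {c : ℝ}, c ≤ 4 * ((d : ℝ) + 1) * Real.exp δ → c * (maj C δ R N (y - y') * s) ≤
      4 * ((d : ℝ) + 1) * Real.exp δ * (maj C δ R N (y - y') * s) := fun hc => mul_le_mul_of_nonneg_right hc hm
  fin_cases n
  · show |conv K lam y| ≤ _
    refine (entry0_le hB hs hsz y).trans ?_
    calc maj C δ R N (y - y') * s = 1 * (maj C δ R N (y - y') * s) := (one_mul _).symm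
      _ ≤ _ := hfac (by nlinarith)
  · show ∑ μ, |fdiffT μ (conv K lam) y| ≤ _
    exact (entry1_le hB hδ hs hsz y).trans (hfac (by nlinarith))
  · show ∑ μ, |conv K (fdiffAdjT μ lam) y| ≤ _
    exact (entry2_le hB hδ hs hsz y).trans (hfac (by nlinarith))
  · show |lapT (conv K lam) y| ≤ _
    exact entry3_le hB hδ hs hsz y

/-- `pref4 1 = ![1, 1, 1, 1]`: at sites of physical size `L^jη = 1` the four scale prefactors of (3.42) are `1`.
[cite: Balaban1985BackgroundPropagators, (3.42) p.397 (prefactors)] -/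
theorem pref4_one (n : Fin 4) : pref4 (1 : ℝ) n = 1 := by
  fin_cases n <;> simp [pref4]

/-- **THE READOUT, SITE ⟹ OPERATOR** (one `(N, k, M)`; `L > 0`, `δ ≥ 0`): the typed site-layer inequality for the
η-difference kernel `Xf − Xc` on the torus carrier, with constants `(C, δ, γ)`, IMPLIES the typed operator-layer inequality
(the four (3.42) entries with King's rate factor) for the η-difference convolution operator on the operator carrier, with
constants `(B0op d δ C, δ, γ) = (4(d+1)e^{δ}C, δ, γ)`.  Mechanism: a point-supported argument collapses `(Kλ)(y)` to
`K(y − y′)λ(y′)`; each entry involves at most four kernel values at `y − y′` and its unit shifts; §0's unit-step bound costs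
`e^{δ}` per shift; `|λ(y′)| ≤ |λ|`. [cite: Balaban1985BackgroundPropagators, (3.42) p.397 + Thm 3.2 (3.48) p.398 (the two shapes); King1986, Lemma 4.5 (4.38) p.674 (A = 0 sibling format)] [folklore] -/
theorem etaRateIneq342_torus_of_site {L : ℝ} (hL : 0 < L) (M : ℝ) (k : ℕ) (Xf Xc : Tor N → ℝ) {C δ γ : ℝ}
    (hδ : 0 ≤ δ) {d' : ℕ} {p : ℝ} {U : pt9Bg.Cfg}
    (h : EtaRateIneqSite d' p (torusStepKernel Xf Xc L M k) C δ γ U) :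
    EtaRateIneq342 (opKernelFamily (N := N) Xf Xc L M k) (B0op d δ C) δ γ U := by
  rw [etaRateIneqSite_torus_iff' hL] at h
  intro n lam y y' hs
  rw [opKernelFamily_e, torusOpGeo_len N hL.ne', pref4_one, mul_one, rateFactor_torusOpGeo N hL,
    rateFactor_torusOpGeo N hL, max_self, torusOpGeo_dist]
  exact opEntries_le (K := fun t => Xf t - Xc t) (R := (L ^ (-γ)) ^ k) h hδ hs (abs_le_supNorm_op N L M k lam y') y n

/-- the POINT MASS at the origin of the unit torus, `𝟙_{0}`. [folklore] -/
def pointMass (N : Fin (d + 1) → ℕ) [∀ μ, NeZero (N μ)] : Tor N → ℝ := fun z => if z = 0 then 1 else 0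

/-- `supp 𝟙_{0} ⊂ {0}`. [folklore] -/
theorem pointMass_suppIn (L M : ℝ) (k : ℕ) : (torusOpGeo d L M k N).suppIn (pointMass N) 0 := by
  intro z hz
  by_contra h
  exact hz (if_neg h)

/-- `|𝟙_{0}| ≤ 1`. [folklore] -/
theorem supNorm_pointMass_le (L M : ℝ) (k : ℕ) : (torusOpGeo d L M k N).supNorm (pointMass N) ≤ 1 :=
  supNorm_op_le N L M k _ fun z => by
    unfold pointMass
    split_ifs <;> simp

/-- `(K𝟙_{0})(y) = K(y)`. [folklore] -/
theorem conv_pointMass (K : Tor N → ℝ) (y : Tor N) : conv K (pointMass N) y = K y := by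
  rw [conv_of_suppIn (pointMass_suppIn (N := N) 0 0 0), sub_zero]
  simp [pointMass]

/-- **THE READOUT, OPERATOR ⟹ SITE** (one `(N, k, M)`; `L > 0`, `B₀ ≥ 0`): entry `0` of the operator-layer inequality against
the point mass `𝟙_{0}` RETURNS the torus step bound `|Xf(t) − Xc(t)| ≤ B₀·e^{−δ|t|_{T,∞}}·(L^{−γ})^k`, i.e. the typed
site-layer inequality with the SAME constants — the operator layer of the model is not weaker than the site layer. [folklore] -/
theorem site_of_etaRateIneq342_torus {L : ℝ} (hL : 0 < L) (M : ℝ) (k : ℕ) (Xf Xc : Tor N → ℝ) {B₀ δ γ : ℝ}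
    (hB : 0 ≤ B₀) {U : pt9Bg.Cfg} (h : EtaRateIneq342 (opKernelFamily (N := N) Xf Xc L M k) B₀ δ γ U)
    (d' : ℕ) (p : ℝ) : EtaRateIneqSite d' p (torusStepKernel Xf Xc L M k) B₀ δ γ U := by
  rw [etaRateIneqSite_torus_iff' hL]
  intro t
  have h1 := h 0 (pointMass N) t 0 (pointMass_suppIn (N := N) L M k)
  rw [opKernelFamily_e, torusOpGeo_len N hL.ne', pref4_one, mul_one, rateFactor_torusOpGeo N hL,
    rateFactor_torusOpGeo N hL, max_self, torusOpGeo_dist, sub_zero, opEntries_zero, conv_pointMass] at h1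
  have hR : 0 ≤ (L ^ (-γ)) ^ k := pow_nonneg (Real.rpow_nonneg hL.le _) k
  have hA : 0 ≤ B₀ * Real.exp (-(δ * torusSupNorm N (rep N t))) * (L ^ (-γ)) ^ k := by positivity
  calc |Xf t - Xc t| ≤ B₀ * Real.exp (-(δ * torusSupNorm N (rep N t))) * (L ^ (-γ)) ^ k *
        (torusOpGeo d L M k N).supNorm (pointMass N) := h1
    _ ≤ B₀ * Real.exp (-(δ * torusSupNorm N (rep N t))) * (L ^ (-γ)) ^ k * 1 :=
        mul_le_mul_of_nonneg_left (supNorm_pointMass_le (N := N) L M k) hA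
    _ = B₀ * Real.exp (-(δ * torusSupNorm N (rep N t))) * (L ^ (-γ)) ^ k := mul_one _

end Readout

/-! ## §4 The paired-instance family over `(k, N, M)` and the packaged readout: `NE2PlusOperator`, `NE2ZeroOperator` -/

section Family

/-- THE IDENTITY η-PAIRING of the runs `k` and `k + 1` on the SAME operator carrier: `n = 1`, `η′L = η`, sites, test functions
(`τ = id`: supports and sup norms preserved) and backgrounds transported identically. [cite: King1986, p.664 (convention before Prop. 3.8)] -/
def torusOpPairing {L : ℝ} (hL : L ≠ 0) (M : ℝ) (k : ℕ) (N : Fin (d + 1) → ℕ) [∀ μ, NeZero (N μ)] :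
    EtaPairing (torusOpGeo d L M k N) (torusOpGeo d L M (k + 1) N) pt9Bg pt9Bg where
  n := 1
  k_eq := rfl
  L_eq := rfl
  M_eq := rfl
  eta_eq := by
    show (L ^ (k + 1))⁻¹ * L ^ 1 = (L ^ k)⁻¹
    rw [pow_one, pow_succ, mul_inv, mul_assoc, inv_mul_cancel₀ hL, mul_one]
  ι := fun y => y
  scale_ι := fun _ => rfl
  dist_ι := fun _ _ => rfl
  τ := fun lam => lam
  suppIn_τ := fun _ _ h => h
  supNorm_τ := fun _ => le_rfl
  avg := fun U => U
  avg_one := rfl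

/-- THE PAIRED-INSTANCE FAMILY of operator carriers over the index `(k, N, M)` of `T4EtaRateSiteTorus.TorusIndex` (runs `k`,
`k + 1` on the same unit torus; all cube sizes `M ≥ 1`; one-point backgrounds; identity pairing). [folklore] -/
def torusOpInstance (d : ℕ) {L : ℝ} (hL : L ≠ 0) (i : TorusIndex d) : PairedInstance :=
  haveI := i.neZero
  { gc := torusOpGeo d L i.M i.k i.N
    gf := torusOpGeo d L i.M (i.k + 1) i.N
    Bc := pt9Bg
    Bf := pt9Bg
    pair := torusOpPairing hL i.M i.k i.N }

/-- The torus family's η-difference OPERATOR families over the index `(k, N, M)`. [folklore] -/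
def torusOpKernelFamilies (X : TorusFamily d) {L : ℝ} (hL : L ≠ 0) :
    ∀ i : TorusIndex d, B9.KernelFamily (torusOpInstance d hL i).gc (torusOpInstance d hL i).Bf :=
  fun i =>
    haveI := i.neZero
    opKernelFamily (X i.N (i.k + 1)) (X i.N i.k) L i.M i.k

variable {X : TorusFamily d} {L : ℝ}

/-- **THE PACKAGED READOUT: `NE2PlusSite` ON THE SITE FAMILY ⟹ `NE2PlusOperator` ON THE OPERATOR FAMILY** (`L > 0`; every
exponent pair `(d′, p)` on the site side, every geometric constant `c35`): constants `(M₅, δ, a₀, C, γ) ↦ (M₅, δ, a₀,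
4(d+1)e^{δ}C, γ)` — uniform in `(k, N, M)` because the readout constant does not see the index.  HONEST SCOPE (ii): at
`U ≡ 1` both packaged types carry NE2⁰ content; NOT NE2⁺.
[cite: Balaban1985BackgroundPropagators, Thm 3.1 p.397 + Thm 3.14 pp.426–427 (quantifier template)] [folklore] -/
theorem ne2PlusOperator_torus_of_ne2PlusSite (hL : 0 < L) {d' : ℕ} {p c35 : ℝ}
    (h : NE2PlusSite d' p c35 (torusInstance d hL.ne') (torusStepKernels X hL.ne')) :
    NE2PlusOperator c35 (torusOpInstance d hL.ne') (torusOpKernelFamilies X hL.ne') := by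
  obtain ⟨M₅, δ, a₀, C, γ, hM, hδ, ha, hC, hγ, H⟩ := h
  refine ⟨M₅, δ, a₀, B0op d δ C, γ, hM, hδ, ha, B0op_pos d δ hC, hγ, fun i hMi α₀ hα hMa U hU => ?_⟩
  haveI := i.neZero
  exact etaRateIneq342_torus_of_site (N := i.N) hL i.M i.k (X i.N (i.k + 1)) (X i.N i.k) hδ.le
    (H i hMi α₀ hα hMa U hU)

/-- **… ⟹ `NE2ZeroOperator` ON THE OPERATOR FAMILY** (the trivial configuration is (3.35)-regular on the one-point carrier).
[folklore] -/
theorem ne2ZeroOperator_torus_of_ne2PlusSite (hL : 0 < L) {d' : ℕ} {p c35 : ℝ}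
    (h : NE2PlusSite d' p c35 (torusInstance d hL.ne') (torusStepKernels X hL.ne')) :
    NE2ZeroOperator (torusOpInstance d hL.ne') (torusOpKernelFamilies X hL.ne') :=
  ne2Zero_of_ne2Plus (fun _ _ _ => trivial) (ne2PlusOperator_torus_of_ne2PlusSite hL h)

/-- **THE CONVERSE: `NE2ZeroOperator` ON THE OPERATOR FAMILY ⟹ `NE2ZeroSite` ON THE SITE FAMILY** (same constants, every
exponent pair). [folklore] -/
theorem ne2ZeroSite_torus_of_ne2ZeroOperator (hL : 0 < L)
    (h : NE2ZeroOperator (torusOpInstance d hL.ne') (torusOpKernelFamilies X hL.ne')) (d' : ℕ) (p : ℝ) :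
    NE2ZeroSite d' p (torusInstance d hL.ne') (torusStepKernels X hL.ne') := by
  obtain ⟨M₅, δ, B₀, γ, hM, hδ, hB, hγ, H⟩ := h
  refine ⟨M₅, δ, B₀, γ, hM, hδ, hB, hγ, fun i hMi => ?_⟩
  haveI := i.neZero
  exact site_of_etaRateIneq342_torus (N := i.N) hL i.M i.k (X i.N (i.k + 1)) (X i.N i.k) hB.le (H i hMi) d' p

/-- **`NE2PlusOperator` IS INHABITED by the operator family of any torus family with a torus step bound whose constants
`(A, δ, γ)` do not depend on `(k, N)`** (`δ, γ > 0`, `L > 0`), for every `c35`. [folklore] -/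
theorem ne2PlusOperator_torus_of_bound_rpow (hL : 0 < L) {A δ γ : ℝ} (hδ : 0 < δ) (hγ : 0 < γ)
    (h : ∀ (N : Fin (d + 1) → ℕ) [∀ μ, NeZero (N μ)] (k : ℕ) (x : Fin (d + 1) → ℤ),
      |X N (k + 1) (toT N x) - X N k (toT N x)| ≤ A * (L ^ k) ^ (-γ) * Real.exp (-(δ * torusSupNorm N x)))
    (c35 : ℝ) : NE2PlusOperator c35 (torusOpInstance d hL.ne') (torusOpKernelFamilies X hL.ne') :=
  ne2PlusOperator_torus_of_ne2PlusSite hL (ne2PlusSite_torus_of_bound_rpow hL hδ hγ h 0 0 c35)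

/-- The same, first order in `η` (`γ = 1`, amplitude `A·(L^k)⁻¹`). [folklore] -/
theorem ne2PlusOperator_torus_of_bound (hL : 0 < L) {A δ : ℝ} (hδ : 0 < δ)
    (h : ∀ (N : Fin (d + 1) → ℕ) [∀ μ, NeZero (N μ)] (k : ℕ) (x : Fin (d + 1) → ℤ),
      |X N (k + 1) (toT N x) - X N k (toT N x)| ≤ A * (L ^ k)⁻¹ * Real.exp (-(δ * torusSupNorm N x)))
    (c35 : ℝ) : NE2PlusOperator c35 (torusOpInstance d hL.ne') (torusOpKernelFamilies X hL.ne') :=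
  ne2PlusOperator_torus_of_bound_rpow hL hδ one_pos (fun N _ k x => by rw [Real.rpow_neg_one]; exact h N k x) c35

/-- **`NE2ZeroOperator` HOLDS for the operator family of any such torus family** (general exponent `γ > 0`). [folklore] -/
theorem ne2ZeroOperator_torus_of_bound_rpow (hL : 0 < L) {A δ γ : ℝ} (hδ : 0 < δ) (hγ : 0 < γ)
    (h : ∀ (N : Fin (d + 1) → ℕ) [∀ μ, NeZero (N μ)] (k : ℕ) (x : Fin (d + 1) → ℤ),
      |X N (k + 1) (toT N x) - X N k (toT N x)| ≤ A * (L ^ k) ^ (-γ) * Real.exp (-(δ * torusSupNorm N x))) :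
    NE2ZeroOperator (torusOpInstance d hL.ne') (torusOpKernelFamilies X hL.ne') :=
  ne2Zero_of_ne2Plus (c35 := 0) (fun _ _ _ => trivial) (ne2PlusOperator_torus_of_bound_rpow hL hδ hγ h 0)

/-- The same, first order in `η` (`γ = 1`). [folklore] -/
theorem ne2ZeroOperator_torus_of_bound (hL : 0 < L) {A δ : ℝ} (hδ : 0 < δ)
    (h : ∀ (N : Fin (d + 1) → ℕ) [∀ μ, NeZero (N μ)] (k : ℕ) (x : Fin (d + 1) → ℤ),
      |X N (k + 1) (toT N x) - X N k (toT N x)| ≤ A * (L ^ k)⁻¹ * Real.exp (-(δ * torusSupNorm N x))) :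
    NE2ZeroOperator (torusOpInstance d hL.ne') (torusOpKernelFamilies X hL.ne') :=
  ne2Zero_of_ne2Plus (c35 := 0) (fun _ _ _ => trivial) (ne2PlusOperator_torus_of_bound hL hδ h 0)

/-- **`NE2ZeroOperator` ON THE OPERATOR FAMILY ⟺ A `(k, N)`-UNIFORM TORUS STEP BOUND WITH POSITIVE CONSTANTS** (amplitude
`A·(L^k)^{−γ}`, `L > 0`): the packaged operator-layer type on the `U ≡ 1` torus family IS the format of the tree's torus rate
theorems — neither vacuous nor more (through `T4EtaRateSiteTorus.exists_bound_of_ne2ZeroSite_torus`). [folklore] -/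
theorem ne2ZeroOperator_torus_iff_bound (hL : 0 < L) :
    NE2ZeroOperator (torusOpInstance d hL.ne') (torusOpKernelFamilies X hL.ne') ↔
      ∃ A δ γ : ℝ, 0 < A ∧ 0 < δ ∧ 0 < γ ∧
        ∀ (N : Fin (d + 1) → ℕ) [∀ μ, NeZero (N μ)] (k : ℕ) (x : Fin (d + 1) → ℤ),
          |X N (k + 1) (toT N x) - X N k (toT N x)| ≤ A * (L ^ k) ^ (-γ) * Real.exp (-(δ * torusSupNorm N x)) :=
  ⟨fun h => exists_bound_of_ne2ZeroSite_torus hL (ne2ZeroSite_torus_of_ne2ZeroOperator hL h 0 0),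
    fun ⟨_, _, _, _, hδ, hγ, h⟩ => ne2ZeroOperator_torus_of_bound_rpow hL hδ hγ h⟩

/-- **`NE2PlusOperator` ON THE OPERATOR FAMILY ⟺ THE SAME STEP BOUND** (every `c35`; HONEST SCOPE (ii): at `U ≡ 1` the
(3.35) side conditions are trivially met, so NE2⁺'s operator TYPE on this family has exactly NE2⁰'s content). [folklore] -/
theorem ne2PlusOperator_torus_iff_bound (hL : 0 < L) (c35 : ℝ) :
    NE2PlusOperator c35 (torusOpInstance d hL.ne') (torusOpKernelFamilies X hL.ne') ↔
      ∃ A δ γ : ℝ, 0 < A ∧ 0 < δ ∧ 0 < γ ∧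
        ∀ (N : Fin (d + 1) → ℕ) [∀ μ, NeZero (N μ)] (k : ℕ) (x : Fin (d + 1) → ℤ),
          |X N (k + 1) (toT N x) - X N k (toT N x)| ≤ A * (L ^ k) ^ (-γ) * Real.exp (-(δ * torusSupNorm N x)) :=
  ⟨fun h => (ne2ZeroOperator_torus_iff_bound hL).mp (ne2Zero_of_ne2Plus (fun _ _ _ => trivial) h),
    fun ⟨_, _, _, _, hδ, hγ, h⟩ => ne2PlusOperator_torus_of_bound_rpow hL hδ hγ h c35⟩

/-- **OPERATOR LAYER ⟺ SITE LAYER ON THE TORUS MODEL** (packaged; every exponent pair `(d′, p)`, every `c35`): G-t4-U1a-5's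
readout in both directions, at `U ≡ 1`. [folklore] -/
theorem ne2PlusOperator_torus_iff_ne2PlusSite (hL : 0 < L) (d' : ℕ) (p c35 : ℝ) :
    NE2PlusOperator c35 (torusOpInstance d hL.ne') (torusOpKernelFamilies X hL.ne') ↔
      NE2PlusSite d' p c35 (torusInstance d hL.ne') (torusStepKernels X hL.ne') := by
  rw [ne2PlusOperator_torus_iff_bound hL c35, T4EtaRateSiteTorus.ne2PlusSite_torus_iff_bound hL d' p c35]

/-- **A SEPARATING FAMILY: the packaged operator type is FALSE for the rate-less torus family `X_N k ≡ 2^k`** (`L = 2`, every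
`d`) — through the converse readout and `T4EtaRateSiteTorus.not_ne2ZeroSite_torus_pow_two`. [folklore] -/
theorem not_ne2ZeroOperator_torus_pow_two (d : ℕ) :
    ¬ NE2ZeroOperator (torusOpInstance d (L := (2 : ℝ)) two_ne_zero)
        (torusOpKernelFamilies (fun _ _ k _ => (2 : ℝ) ^ k) two_ne_zero) :=
  fun h => not_ne2ZeroSite_torus_pow_two d 0 0 (ne2ZeroSite_torus_of_ne2ZeroOperator two_pos h 0 0)

/-- … hence `NE2PlusOperator` is FALSE for that family too (every `c35`). [folklore] -/
theorem not_ne2PlusOperator_torus_pow_two (d : ℕ) (c35 : ℝ) :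
    ¬ NE2PlusOperator c35 (torusOpInstance d (L := (2 : ℝ)) two_ne_zero)
        (torusOpKernelFamilies (fun _ _ k _ => (2 : ℝ) ^ k) two_ne_zero) :=
  fun h => not_ne2ZeroOperator_torus_pow_two d (ne2Zero_of_ne2Plus (fun _ _ _ => trivial) h)

end Family

/-! ## §5 Inhabitants BY NAME: the (1.66)-layer torus entry kernels, at `γ = 1` and at King's `γ = 2` -/

section Layer166

variable {N : Fin (d + 1) → ℕ} [∀ μ, NeZero (N μ)]

/-- **THE (1.66) LAYER INHABITS THE TYPED OPERATOR LAYER ON EVERY UNIT TORUS** (every `L ≥ 1`, `μ ≠ ν`, `a`, `b`, `N`, `M`,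
`k`, at `U ≡ 1`), EXPLICIT constants: `EtaRateIneq342 (opKernelFamily (X_N (k+1)) (X_N k) L M k) (B0op d (delta166T d)
(C166T d)) (delta166T d) 1 U` for `X_N k = Re K^{(L^k)}_{ab,N}` — through the site inhabitant
`T4EtaRateSiteTorus.etaRateIneqSite_ksum166` and the §3 readout.
[cite: Balaban1984PropagatorsI, (1.66) p.29 (object); Balaban1985BackgroundPropagators, (3.42) p.397 (shape)] [folklore] -/
theorem etaRateIneq342_ksum166 (L : ℕ) [NeZero L] {μ ν : Fin (d + 1)} (hμν : μ ≠ ν) (a b : Fin (d + 1))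
    (N : Fin (d + 1) → ℕ) [∀ μ, NeZero (N μ)] (M : ℝ) (k : ℕ) (U : pt9Bg.Cfg) :
    EtaRateIneq342
      (opKernelFamily (N := N) (ksum166Family L μ ν a b N (k + 1)) (ksum166Family L μ ν a b N k) (L : ℝ) M k)
      (B0op d (delta166T d) (C166T d)) (delta166T d) 1 U :=
  etaRateIneq342_torus_of_site (by exact_mod_cast Nat.pos_of_ne_zero (NeZero.ne L)) M k _ _ (delta166T_pos d).le
    (T4EtaRateSiteTorus.etaRateIneqSite_ksum166 L hμν a b N M k 0 0 U)

/-- **`NE2PlusOperator` IS INHABITED BY THE (1.66) TORUS FAMILY, UNIFORMLY IN THE VOLUME** (every `L ≥ 1`, `μ ≠ ν`, `a`, `b`;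
`γ = 1`, `δ = delta166T d`, `B₀ = 4(d+1)e^{δ}·max (C166T d) 1`), for every geometric constant `c35` — THE FIRST INHABITANT OF
`T4EtaRate.NE2PlusOperator` IN THE TREE.  HONEST SCOPE (ii): NE2⁰ content inside NE2⁺'s type; NOT NE2⁺.
[cite: Balaban1984PropagatorsI, (1.66) p.29 (object); Balaban1985BackgroundPropagators, Thm 3.1 p.397 + Thm 3.14 pp.426–427 (quantifier template)] [folklore] -/
theorem ne2PlusOperator_ksum166 (L : ℕ) [NeZero L] {μ ν : Fin (d + 1)} (hμν : μ ≠ ν) (a b : Fin (d + 1)) (c35 : ℝ) :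
    NE2PlusOperator c35
      (torusOpInstance d (L := (L : ℝ)) (by exact_mod_cast NeZero.ne L))
      (torusOpKernelFamilies (ksum166Family (d := d) L μ ν a b) (by exact_mod_cast NeZero.ne L)) :=
  ne2PlusOperator_torus_of_ne2PlusSite (by exact_mod_cast Nat.pos_of_ne_zero (NeZero.ne L))
    (ne2PlusSite_ksum166 L hμν a b 0 0 c35)

/-- **`NE2ZeroOperator` IS A THEOREM for the (1.66) torus family** (every `L ≥ 1`, `μ ≠ ν`): the `A = 0` operator-layer shape
holds on every unit torus with `γ = 1`, `δ = delta166T d`, hypothesis-free, uniformly in `(k, N, M)` — THE FIRST INHABITANT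
OF `T4EtaRate.NE2ZeroOperator` IN THE TREE.
[cite: Balaban1984PropagatorsI, (1.66) p.29 (object); King1986, Props. 3.8–3.9 (3.71)–(3.75) pp.664–665 (A = 0 model, shape)] [folklore] -/
theorem ne2ZeroOperator_ksum166 (L : ℕ) [NeZero L] {μ ν : Fin (d + 1)} (hμν : μ ≠ ν) (a b : Fin (d + 1)) :
    NE2ZeroOperator
      (torusOpInstance d (L := (L : ℝ)) (by exact_mod_cast NeZero.ne L))
      (torusOpKernelFamilies (ksum166Family (d := d) L μ ν a b) (by exact_mod_cast NeZero.ne L)) :=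
  ne2ZeroOperator_torus_of_ne2PlusSite (c35 := 0) (by exact_mod_cast Nat.pos_of_ne_zero (NeZero.ne L))
    (ne2PlusSite_ksum166 L hμν a b 0 0 0)

/-- **THE SAME AT KING'S FULL EXPONENT `γ = 2`**, explicit constants: `EtaRateIneq342 (opKernelFamily (X_N (k+1)) (X_N k) L M k)
(B0op d (delta166T2 d) (C166T2 d)) (delta166T2 d) 2 U` — through `T4EtaRateSiteTorus.etaRateIneqSite_ksum166_king`.
[cite: Balaban1984PropagatorsI, (1.66) p.29 (object); King1986, Prop. 3.9 (3.73) p.665 (the exponent)] [folklore] -/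
theorem etaRateIneq342_ksum166_king (L : ℕ) [NeZero L] {μ ν : Fin (d + 1)} (hμν : μ ≠ ν) (a b : Fin (d + 1))
    (N : Fin (d + 1) → ℕ) [∀ μ, NeZero (N μ)] (M : ℝ) (k : ℕ) (U : pt9Bg.Cfg) :
    EtaRateIneq342
      (opKernelFamily (N := N) (ksum166Family L μ ν a b N (k + 1)) (ksum166Family L μ ν a b N k) (L : ℝ) M k)
      (B0op d (delta166T2 d) (C166T2 d)) (delta166T2 d) 2 U :=
  etaRateIneq342_torus_of_site (by exact_mod_cast Nat.pos_of_ne_zero (NeZero.ne L)) M k _ _ (delta166T2_pos d).le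
    (T4EtaRateSiteTorus.etaRateIneqSite_ksum166_king L hμν a b N M k 0 0 U)

/-- **`NE2PlusOperator` IS INHABITED BY THE (1.66) TORUS FAMILY AT KING'S EXPONENT `γ = 2`, UNIFORMLY IN THE VOLUME** (every
`L ≥ 1`, `μ ≠ ν`; `δ = delta166T2 d`), for every `c35`.  HONEST SCOPE (ii): NE2⁰ content inside NE2⁺'s type; NOT NE2⁺.
[cite: Balaban1984PropagatorsI, (1.66) p.29 (object); King1986, Prop. 3.9 (3.73) p.665 (the exponent); Balaban1985BackgroundPropagators, Thm 3.14 pp.426–427 (quantifier template)] [folklore] -/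
theorem ne2PlusOperator_ksum166_king (L : ℕ) [NeZero L] {μ ν : Fin (d + 1)} (hμν : μ ≠ ν) (a b : Fin (d + 1))
    (c35 : ℝ) :
    NE2PlusOperator c35
      (torusOpInstance d (L := (L : ℝ)) (by exact_mod_cast NeZero.ne L))
      (torusOpKernelFamilies (ksum166Family (d := d) L μ ν a b) (by exact_mod_cast NeZero.ne L)) :=
  ne2PlusOperator_torus_of_ne2PlusSite (by exact_mod_cast Nat.pos_of_ne_zero (NeZero.ne L))
    (ne2PlusSite_ksum166_king L hμν a b 0 0 c35)

/-- **`NE2ZeroOperator` IS A THEOREM for the (1.66) torus family AT KING'S EXPONENT** (every `L ≥ 1`, `μ ≠ ν`): `γ = 2`,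
`δ = delta166T2 d`, hypothesis-free, uniformly in `(k, N, M)`.
[cite: Balaban1984PropagatorsI, (1.66) p.29 (object); King1986, Prop. 3.9 (3.73) p.665 (the exponent) and Props. 3.8–3.9 pp.664–665 (A = 0 model, shape)] [folklore] -/
theorem ne2ZeroOperator_ksum166_king (L : ℕ) [NeZero L] {μ ν : Fin (d + 1)} (hμν : μ ≠ ν) (a b : Fin (d + 1)) :
    NE2ZeroOperator
      (torusOpInstance d (L := (L : ℝ)) (by exact_mod_cast NeZero.ne L))
      (torusOpKernelFamilies (ksum166Family (d := d) L μ ν a b) (by exact_mod_cast NeZero.ne L)) :=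
  ne2ZeroOperator_torus_of_ne2PlusSite (c35 := 0) (by exact_mod_cast Nat.pos_of_ne_zero (NeZero.ne L))
    (ne2PlusSite_ksum166_king L hμν a b 0 0 0)

end Layer166

end

end Literature.MathematicalPhysics.QuantumFieldTheory.Balaban1983to89.T4EtaRateOperatorTorus
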